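import Summits.BirchSwinnertonDyer.BirchSwinnertonDyer.Theorems.KimAtThreeDeepLowerKatoExactFinal
import Summits.BirchSwinnertonDyer.BirchSwinnertonDyer.Theorems.KimAtThreeDeepUpperZetaBodyC3UniformFacts
import Summits.BirchSwinnertonDyer.BirchSwinnertonDyer.Theorems.KimAtThreeFineKatoDefinedLambdaExpStarDefs
import HarnessLib

/-!
# Crux `DeepUpperAtThree` (19076) and the deep leaf of W2 from cite facts and the PRINT-SHAPED Kato package hKatoPᵘ
# — Kato 2004 (8.1.3)/8.12/8.5/13.3 [(C1)(C2)], Thm. 9.7 [(C4)] and Thm. 6.6 (1) [(C5)] for the DEFINED value datum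
# `katoLambda`, NOTHING ELSE (route `KimAtThreeKolyvagin`, rung W2; cell `bsd-addord`, seat w2-c3 gen 9; `--supports 19076`, helper)

HONEST FRAMING.  Glue/TOOL theorems only (no definition, no instance attribute, no `sorry`); hKatoPᵘ is a DISPLAYED
hypothesis; (P123)/(DR)/(S5a)/(S5b)/(S5b-tower) are the cite-only named facts of `PAdicHodge/DualExpElliptic{,Tower}`
taken as theorem binders; every conclusion is a route decl BY NAME but CONDITIONAL; nothing is closed or booked;
BSD is not proved by any of this.

WHAT.  After w2-c2 g9 (`KimAtThreeDeepLowerKatoExactFinal`, p523832) the deep leaf of W2 reads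
19075 / 19679 / 19076 / 19562 / 20013 / `N11.KimAtThreeDeepPUB` ⟸ 4 cite leaves ∧ 5 cite facts ∧ **hKatoExᵘ**, where
hKatoExᵘ still carries THREE non-print ingredients: an abstract value datum `∃ Λ`, the pinning clauses (DEF₀) (with
their per-level data `∃ w₀ g dw …`), and `ZetaBody`'s own-attribution clauses (C3a)/(C3b).  With w2-acc5 g6's
DEFINITION `katoLambda` (p526036, `Λ_{k,r} := Ψ⁻¹ ∘ (w ↦ (g̃_w⁻¹)_* exp*_{w₀}(loc^{tower}_{w₀}(g_w · y)))`) and this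
seat's stratum-free (C3) tool (`KimAtThreeDeepUpperZetaBodyC3Uniform{,Facts}`, p525561/p526368) all three are
KERNEL, on EVERY tower row:

* **hKatoPᵘ** (displayed; text below) := per surjective-tower curve `W`, optimal parametrisation `P` at the conductor
  with the Manin-lattice clause: `∃ dK ι κK` and per-level charts `(w₀, Ψ, hΨ, g, hg, dw, hinjw, hexw)_{k,r}`
  (ONE place `w₀ ∣ 3` of `ℚ(ζ_m)`, the semi-local decomposition `Ψ`, a twist family `g`, a line datum `dw` at
  `L_{w₀}` with its Prop-1.2.3 binders) such that `κK ≠ 0`, (RES₀) `exp*_{dw} ∘ res = (ℚ_v → L_{w₀}) ∘ exp*_{dK}` at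
  every level, and for all admissible `(c, d, a, A)`: `∃ z x`, (C1) `z` is an Euler system, (C2) unramified away from
  `3`, (C4) **`katoLambda(chart_{k,r}) (z_{k,r}) = 1 ⊗ x_{k,r}`** (Kato Thm. 9.7: the dual exponential of the zeta
  element in the Néron coordinate is the RATIONAL element `x_{k,r} ∈ ℚ(ζ_m)`), (C5) the value law — the clauses
  (C1)(C2)(C5) are `Kato2004.ZetaBody`'s VERBATIM; NO `∃ Λ`, NO (DEF₀), NO (C3a)/(C3b).
* `katoExact_of_katoPrint_of_facts : (P123) → (DR) → (S5b) → hKatoPᵘ → hKatoExᵘ` — `Λ := fun k r ↦ katoLambda(chart)`;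
  (DEF₀) for every `Ψ'` with the pure-tensor formula by `Ψ' = Ψ` (uniqueness, `padicTensor_ext`) and w2-acc5's
  cocycle-level unfolding of `katoLambda`; (C3a)/(C3b) by `zetaBody_C3_of_level_of_facts` ((S5b) gives a class with
  `exp*_{dK} ≠ 0` on every row; (RES₀) pins `dw`; kim3's `expStarOmega_galois`).
* `deepUpperAtThree_of_katoPrint_of_facts` — ★ crux 19076 BY NAME ⟸ 4 leaves ∧ {P123, DR, S5a, S5b, S5b-tower} ∧ hKatoPᵘ;
  `deepLowerAtThree_…`, `deepUpperAtThreeOffKatoStratum_…`, `definedKatoUniformThree_…`, `kimAtThreeDeepPUB_…` likewise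
  (∘ w2-c2's `KimAtThreeDeepLowerKatoExactFinal`).

So the displayed Kato-side residual of 19076 is PRINT over DEFINED objects: Kato's Euler system of zeta elements with
its norm relations and unramifiedness, and the values of the DEFINED semi-local dual exponential on them (Thm. 9.7)
with the value law (Thm. 6.6 (1)) — the statement the typer lane re-types under `Literature/` (w2-c2 g9 draft).

References: K. Kato, Astérisque 295 (2004) (8.1.3) p. 180, §8.2–Lemma 8.5 pp. 180–184, Prop. 8.12 p. 186, §9.4 p. 188,
Thm. 9.7 p. 189, Thm. 6.6 (1) p. 163, §13.1 / Ex. 13.3 pp. 224–225 [Kato2004Asterisque]; K. Kato, LNM 1553 (1993) II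
§1.2.4, Prop. 1.2.3, Thm. 1.4.1 [Kato1993LNM1553]; S. Bloch, K. Kato (1990) §3 Prop. 3.8, Ex. 3.11 [BlochKato1990];
J. W. S. Cassels, A. Fröhlich (1967) II §10 (10.2), VII §1.1 [CasselsFrohlichANT1967]; K. Rubin, *Euler Systems* (2000)
Def. 2.1.1 [Rubin2000]; [Kim2025RefinedTNC] Thm. 1.1; [Sakamoto2024] Thm. 4.4; [MazurRubin2004] Thm. 5.2.12; [Carayol1986].
-/

noncomputable section

-- the cell's Theorems namespace `Summit.BirchSwinnertonDyer.BirchSwinnertonDyer.…` repeats the summit name by design (D-0017)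
set_option linter.dupNamespace false

open scoped Classical NumberField TensorProduct ContRepresentation Pointwise
open Field ValuativeRel Function IsDedekindDomain NumberField
open WeierstrassCurve Literature.NumberTheory.EllipticCurves Literature.NumberTheory.GaloisRepresentations
  Literature.NumberTheory.GaloisRepresentations.DiscreteGaloisModule Literature.NumberTheory.GaloisCohomology
open Literature.NumberTheory.GaloisRepresentations.PeriodRingData Literature.NumberTheory.PAdicHodge
open Literature.NumberTheory.EllipticCurves.ModularForms Literature.NumberTheory.EllipticCurves.Rank1Residual
open Literature.NumberTheory.EllipticCurves.Kato2004 Literature.NumberTheory.EllipticCurves.Kato2004.EulerSystemValues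
open Literature.NumberTheory.AdelicBaseChange Literature.NumberTheory.Automorphic
open Summit.BirchSwinnertonDyer.Rank1Residual.GaloisImage
open Summit.BirchSwinnertonDyer.Rank1Residual.Additive
open Summit.BirchSwinnertonDyer.Rank1Residual.Additive.LocalLog
open Summit.BirchSwinnertonDyer.BirchSwinnertonDyer.Theses.KimAtThreeKolyvagin
open Summit.BirchSwinnertonDyer.BirchSwinnertonDyer.Theorems
open Summit.BirchSwinnertonDyer.BirchSwinnertonDyer.Theorems.KimAtThreeFineKatoPerFactorDefined
open Summit.BirchSwinnertonDyer.BirchSwinnertonDyer.Theorems.KimAtThreeFineKatoLevelCompat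
open Summit.BirchSwinnertonDyer.BirchSwinnertonDyer.Theorems.KimAtThreeFineKatoLevelCompatDef
open Summit.BirchSwinnertonDyer.BirchSwinnertonDyer.Theorems.KimAtThreeDeepLowerExpStarOmega
open Summit.BirchSwinnertonDyer.BirchSwinnertonDyer.Theorems.KimAtThreeDeepLowerExpStarOmegaPlace
open Summit.BirchSwinnertonDyer.BirchSwinnertonDyer.Theorems.KimAtThreeFineKatoPerFactorPlaces
open Summit.BirchSwinnertonDyer.BirchSwinnertonDyer.Theorems.KimAtThreeDeepUpperExpStarFacts
open Summit.BirchSwinnertonDyer.BirchSwinnertonDyer.Theorems.KimAtThreeFineKatoPrintClauses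
open Summit.BirchSwinnertonDyer.BirchSwinnertonDyer.Theorems.KimAtThreeDeepUpperZetaBodyC3Uniform
open Summit.BirchSwinnertonDyer.BirchSwinnertonDyer.Theorems.KimAtThreeDeepUpperZetaBodyC3UniformFacts
open Summit.BirchSwinnertonDyer.BirchSwinnertonDyer.Theorems.KimAtThreeFineKatoDefinedLambda
open Summit.BirchSwinnertonDyer.BirchSwinnertonDyer.Theorems.KimAtThreeDeepLowerKatoExactFinal

namespace Summit.BirchSwinnertonDyer.BirchSwinnertonDyer.Theorems.KimAtThreeDeepUpperOfKatoPrint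

/-! ### §0 `Ψ` is unique -/

/-- **The semi-local decomposition `Ψ : ℚ_p ⊗ L ≃ ∏_{w ∣ p} L_w` is determined by its pure-tensor formula**
(two `ℚ`-algebra isomorphisms with the same values on pure tensors agree: pure tensors span).
[cite: CasselsFrohlichANT1967, Ch. II §10 Theorem (10.2)] -/
theorem padicTensor_ext (L : Type) [Field L] [NumberField L] (p : ℕ) [Fact p.Prime]
    (Ψ Ψ' : ℚ_[p] ⊗[ℚ] L ≃ₐ[ℚ]
      (Π w : ((Rat.HeightOneSpectrum.primesEquiv (R := 𝓞 ℚ)).symm ⟨p, Fact.out⟩).Extension (𝓞 L),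
        w.1.adicCompletion L))
    (hΨ : ∀ (s : ℚ_[p]) (x : L)
      (w : ((Rat.HeightOneSpectrum.primesEquiv (R := 𝓞 ℚ)).symm ⟨p, Fact.out⟩).Extension (𝓞 L)),
      Ψ (s ⊗ₜ[ℚ] x) w = algebraMap L (w.1.adicCompletion L) x *
        algebraMap (((Rat.HeightOneSpectrum.primesEquiv (R := 𝓞 ℚ)).symm ⟨p, Fact.out⟩).adicCompletion ℚ)
          (w.1.adicCompletion L) (Padic.adicCompletionEquiv (𝓞 ℚ) ⟨p, Fact.out⟩ s))
    (hΨ' : ∀ (s : ℚ_[p]) (x : L)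
      (w : ((Rat.HeightOneSpectrum.primesEquiv (R := 𝓞 ℚ)).symm ⟨p, Fact.out⟩).Extension (𝓞 L)),
      Ψ' (s ⊗ₜ[ℚ] x) w = algebraMap L (w.1.adicCompletion L) x *
        algebraMap (((Rat.HeightOneSpectrum.primesEquiv (R := 𝓞 ℚ)).symm ⟨p, Fact.out⟩).adicCompletion ℚ)
          (w.1.adicCompletion L) (Padic.adicCompletionEquiv (𝓞 ℚ) ⟨p, Fact.out⟩ s)) :
    Ψ = Ψ' := by
  apply AlgEquiv.ext
  intro t
  induction t using TensorProduct.induction_on with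
  | zero => simp
  | tmul s x => funext w; rw [hΨ, hΨ']
  | add t₁ t₂ h₁ h₂ => rw [map_add, map_add, h₁, h₂]

/-! ### §1 hKatoPᵘ → hKatoExᵘ -/

variable
    (hKatoP : ∀ (W : WeierstrassCurve ℚ) [W.IsElliptic] [W.IsGloballyMinimal]
      [ContinuousSMul ℤ_[3] (W.tateModule 3)] [Module.Free ℤ_[3] (W.tateModule 3)]
      [Module.Finite ℤ_[3] (W.tateModule 3)],
      (∀ m : ℕ, W.HasSurjectiveModNGaloisRep (3 ^ m : ℕ)) →
      ∀ {N : ℕ} [NeZero N] (P : ModularParametrizationData W N), N = W.conductorNorm ℤ →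
        (∀ z ∈ P.L.lattice, ∃ w ∈ periodLattice P.f, z = P.c * w) →
        haveI : Fact (((3 : ℕ) : 𝓞 ℚ) ∈ ((Rat.HeightOneSpectrum.primesEquiv (R := 𝓞 ℚ)).symm ⟨3, Fact.out⟩).asIdeal) :=
          ⟨(natCast_mem_asIdeal_iff_eq_primesEquiv_symm _ Nat.prime_three).mpr rfl⟩
        letI := valuativeRelPlace ((Rat.HeightOneSpectrum.primesEquiv (R := 𝓞 ℚ)).symm ⟨3, Fact.out⟩)
        letI := topologicalSpacePlace ((Rat.HeightOneSpectrum.primesEquiv (R := 𝓞 ℚ)).symm ⟨3, Fact.out⟩)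
        haveI := isNonarchimedeanLocalField_place ((Rat.HeightOneSpectrum.primesEquiv (R := 𝓞 ℚ)).symm ⟨3, Fact.out⟩)
        haveI := charZero_place ((Rat.HeightOneSpectrum.primesEquiv (R := 𝓞 ℚ)).symm ⟨3, Fact.out⟩)
        letI := padicAlgebraPlace 3 ((Rat.HeightOneSpectrum.primesEquiv (R := 𝓞 ℚ)).symm ⟨3, Fact.out⟩)
        haveI := fact_not_isUnit_place 3 ((Rat.HeightOneSpectrum.primesEquiv (R := 𝓞 ℚ)).symm ⟨3, Fact.out⟩)
        haveI := isAdicComplete_place 3 ((Rat.HeightOneSpectrum.primesEquiv (R := 𝓞 ℚ)).symm ⟨3, Fact.out⟩)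
        ∃ (dK : LocalNeronLineAt W 3 ((Rat.HeightOneSpectrum.primesEquiv (R := 𝓞 ℚ)).symm ⟨3, Fact.out⟩))
          (ι : (n : ℕ) → (CyclotomicField n ℚ →+* ℂ)) (κK : ℝ)
          (w₀ : ∀ (k : ℕ) (r : Finset (HeightOneSpectrum (𝓞 ℚ))), (((Rat.HeightOneSpectrum.primesEquiv (R := 𝓞 ℚ)).symm ⟨3, Fact.out⟩).Extension (𝓞 (CyclotomicField (cycLevel 3 k r) ℚ))))
          (Ψ : ∀ (k : ℕ) (r : Finset (HeightOneSpectrum (𝓞 ℚ))), ℚ_[3] ⊗[ℚ] CyclotomicField (cycLevel 3 k r) ℚ ≃ₐ[ℚ]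
            (Π w : (((Rat.HeightOneSpectrum.primesEquiv (R := 𝓞 ℚ)).symm ⟨3, Fact.out⟩).Extension (𝓞 (CyclotomicField (cycLevel 3 k r) ℚ))), w.1.adicCompletion (CyclotomicField (cycLevel 3 k r) ℚ)))
          (hΨ : ∀ (k : ℕ) (r : Finset (HeightOneSpectrum (𝓞 ℚ))) (s : ℚ_[3]) (x : CyclotomicField (cycLevel 3 k r) ℚ) (w : (((Rat.HeightOneSpectrum.primesEquiv (R := 𝓞 ℚ)).symm ⟨3, Fact.out⟩).Extension (𝓞 (CyclotomicField (cycLevel 3 k r) ℚ)))),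
            Ψ k r (s ⊗ₜ[ℚ] x) w =
              algebraMap (CyclotomicField (cycLevel 3 k r) ℚ) (w.1.adicCompletion (CyclotomicField (cycLevel 3 k r) ℚ)) x *
              algebraMap (((Rat.HeightOneSpectrum.primesEquiv (R := 𝓞 ℚ)).symm ⟨3, Fact.out⟩).adicCompletion ℚ) (w.1.adicCompletion (CyclotomicField (cycLevel 3 k r) ℚ))
                ((Padic.adicCompletionEquiv (𝓞 ℚ) ⟨3, Fact.out⟩) s))
          (g : ∀ (k : ℕ) (r : Finset (HeightOneSpectrum (𝓞 ℚ))), (((Rat.HeightOneSpectrum.primesEquiv (R := 𝓞 ℚ)).symm ⟨3, Fact.out⟩).Extension (𝓞 (CyclotomicField (cycLevel 3 k r) ℚ))) → absoluteGaloisGroup ℚ)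
          (hg : ∀ (k : ℕ) (r : Finset (HeightOneSpectrum (𝓞 ℚ))) (w : (((Rat.HeightOneSpectrum.primesEquiv (R := 𝓞 ℚ)).symm ⟨3, Fact.out⟩).Extension (𝓞 (CyclotomicField (cycLevel 3 k r) ℚ)))),
            sigma (cycLevel 3 k r) (modNCyclotomicCharacter ℚ (cycLevel 3 k r) (g k r w)) • w.1 = (w₀ k r).1)
          (dw : ∀ (k : ℕ) (r : Finset (HeightOneSpectrum (𝓞 ℚ))),
            letI := LocalField.charZero_adicCompletion (w₀ k r).1
            letI := LocalField.adicCompletionPadicAlgebra (w₀ k r).1 3 (three_mem_asIdeal_extension _ (w₀ k r))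
            haveI : Fact (¬ IsUnit ((3 : ℕ) : integerC ((w₀ k r).1.adicCompletion (CyclotomicField (cycLevel 3 k r) ℚ)))) :=
              ⟨not_isUnit_natCast_integerC (LocalField.valuation_adicCompletion_natCast_lt_one (w₀ k r).1 3 (three_mem_asIdeal_extension _ (w₀ k r)))⟩
            haveI := isAdicComplete_integerC_natCast (LocalField.valuation_adicCompletion_natCast_lt_one (w₀ k r).1 3 (three_mem_asIdeal_extension _ (w₀ k r)))
            LocalNeronLine W (LocalField.valuation_adicCompletion_natCast_lt_one (w₀ k r).1 3 (three_mem_asIdeal_extension _ (w₀ k r))) ((galRestrictPlace ((Rat.HeightOneSpectrum.primesEquiv (R := 𝓞 ℚ)).symm ⟨3, Fact.out⟩)).comp (absGaloisRestrict (((Rat.HeightOneSpectrum.primesEquiv (R := 𝓞 ℚ)).symm ⟨3, Fact.out⟩).adicCompletion ℚ) ((w₀ k r).1.adicCompletion (CyclotomicField (cycLevel 3 k r) ℚ)))))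
          (hinjw : ∀ (k : ℕ) (r : Finset (HeightOneSpectrum (𝓞 ℚ))),
            letI := LocalField.charZero_adicCompletion (w₀ k r).1
            letI := LocalField.adicCompletionPadicAlgebra (w₀ k r).1 3 (three_mem_asIdeal_extension _ (w₀ k r))
            haveI : Fact (¬ IsUnit ((3 : ℕ) : integerC ((w₀ k r).1.adicCompletion (CyclotomicField (cycLevel 3 k r) ℚ)))) :=
              ⟨not_isUnit_natCast_integerC (LocalField.valuation_adicCompletion_natCast_lt_one (w₀ k r).1 3 (three_mem_asIdeal_extension _ (w₀ k r)))⟩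
            haveI := isAdicComplete_integerC_natCast (LocalField.valuation_adicCompletion_natCast_lt_one (w₀ k r).1 3 (three_mem_asIdeal_extension _ (w₀ k r)))
            (bdRPeriodRingData (LocalField.valuation_adicCompletion_natCast_lt_one (w₀ k r).1 3 (three_mem_asIdeal_extension _ (w₀ k r)))).CupLogInjective (logCyclotomic 3) (localRationalTateRep W 3 ((galRestrictPlace ((Rat.HeightOneSpectrum.primesEquiv (R := 𝓞 ℚ)).symm ⟨3, Fact.out⟩)).comp (absGaloisRestrict (((Rat.HeightOneSpectrum.primesEquiv (R := 𝓞 ℚ)).symm ⟨3, Fact.out⟩).adicCompletion ℚ) ((w₀ k r).1.adicCompletion (CyclotomicField (cycLevel 3 k r) ℚ))))))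
          (hexw : ∀ (k : ℕ) (r : Finset (HeightOneSpectrum (𝓞 ℚ))),
            letI := LocalField.charZero_adicCompletion (w₀ k r).1
            letI := LocalField.adicCompletionPadicAlgebra (w₀ k r).1 3 (three_mem_asIdeal_extension _ (w₀ k r))
            haveI : Fact (¬ IsUnit ((3 : ℕ) : integerC ((w₀ k r).1.adicCompletion (CyclotomicField (cycLevel 3 k r) ℚ)))) :=
              ⟨not_isUnit_natCast_integerC (LocalField.valuation_adicCompletion_natCast_lt_one (w₀ k r).1 3 (three_mem_asIdeal_extension _ (w₀ k r)))⟩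
            haveI := isAdicComplete_integerC_natCast (LocalField.valuation_adicCompletion_natCast_lt_one (w₀ k r).1 3 (three_mem_asIdeal_extension _ (w₀ k r)))
            ∀ z : contOneCocycles (localRationalTateRep W 3 ((galRestrictPlace ((Rat.HeightOneSpectrum.primesEquiv (R := 𝓞 ℚ)).symm ⟨3, Fact.out⟩)).comp (absGaloisRestrict (((Rat.HeightOneSpectrum.primesEquiv (R := 𝓞 ℚ)).symm ⟨3, Fact.out⟩).adicCompletion ℚ) ((w₀ k r).1.adicCompletion (CyclotomicField (cycLevel 3 k r) ℚ))))).toTopRep,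
              (bdRPeriodRingData (LocalField.valuation_adicCompletion_natCast_lt_one (w₀ k r).1 3 (three_mem_asIdeal_extension _ (w₀ k r)))).HasDualExp (logCyclotomic 3) (localRationalTateRep W 3 ((galRestrictPlace ((Rat.HeightOneSpectrum.primesEquiv (R := 𝓞 ℚ)).symm ⟨3, Fact.out⟩)).comp (absGaloisRestrict (((Rat.HeightOneSpectrum.primesEquiv (R := 𝓞 ℚ)).symm ⟨3, Fact.out⟩).adicCompletion ℚ) ((w₀ k r).1.adicCompletion (CyclotomicField (cycLevel 3 k r) ℚ))))) fun σ => z.1 σ),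
          κK ≠ 0 ∧
          (∀ (k : ℕ) (r : Finset (HeightOneSpectrum (𝓞 ℚ))),
            letI := LocalField.charZero_adicCompletion (w₀ k r).1
            letI := LocalField.adicCompletionPadicAlgebra (w₀ k r).1 3 (three_mem_asIdeal_extension _ (w₀ k r))
            haveI : Fact (¬ IsUnit ((3 : ℕ) : integerC ((w₀ k r).1.adicCompletion (CyclotomicField (cycLevel 3 k r) ℚ)))) :=
              ⟨not_isUnit_natCast_integerC (LocalField.valuation_adicCompletion_natCast_lt_one (w₀ k r).1 3 (three_mem_asIdeal_extension _ (w₀ k r)))⟩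
            haveI := isAdicComplete_integerC_natCast (LocalField.valuation_adicCompletion_natCast_lt_one (w₀ k r).1 3 (three_mem_asIdeal_extension _ (w₀ k r)))
            ∀ (h : (tateLocalRep W 3 (Sum.inr ((Rat.HeightOneSpectrum.primesEquiv (R := 𝓞 ℚ)).symm ⟨3, Fact.out⟩))).cohomology 1),
              expStarOmegaHom (LocalField.valuation_adicCompletion_natCast_lt_one (w₀ k r).1 3 (three_mem_asIdeal_extension _ (w₀ k r))) ((galRestrictPlace ((Rat.HeightOneSpectrum.primesEquiv (R := 𝓞 ℚ)).symm ⟨3, Fact.out⟩)).comp (absGaloisRestrict (((Rat.HeightOneSpectrum.primesEquiv (R := 𝓞 ℚ)).symm ⟨3, Fact.out⟩).adicCompletion ℚ) ((w₀ k r).1.adicCompletion (CyclotomicField (cycLevel 3 k r) ℚ)))) (dw k r) (hinjw k r) (hexw k r)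
                (ContinuousRep.cohomologyRes (tateLocalRep W 3 (Sum.inr ((Rat.HeightOneSpectrum.primesEquiv (R := 𝓞 ℚ)).symm ⟨3, Fact.out⟩)))
                  (absGaloisRestrict (((Rat.HeightOneSpectrum.primesEquiv (R := 𝓞 ℚ)).symm ⟨3, Fact.out⟩).adicCompletion ℚ) ((w₀ k r).1.adicCompletion (CyclotomicField (cycLevel 3 k r) ℚ))) 1 h) =
              algebraMap (((Rat.HeightOneSpectrum.primesEquiv (R := 𝓞 ℚ)).symm ⟨3, Fact.out⟩).adicCompletion ℚ) ((w₀ k r).1.adicCompletion (CyclotomicField (cycLevel 3 k r) ℚ)) (expStarOmegaAt dK h)) ∧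
          ∀ (c d a : ℤ) (A : ℕ), 0 < A → Int.gcd c (6 * 3 * A) = 1 → Int.gcd d (6 * 3 * N) = 1 →
            ∃ (z : ∀ (k' : ℕ) (r : (cyclotomicLevelsRat 3 (badPlaces c d A N)).Ideals),
                  H1 (tateRep W 3) ((cyclotomicLevelsRat 3 (badPlaces c d A N)).level k' r.1))
              (x : ∀ (k' : ℕ) (r : (cyclotomicLevelsRat 3 (badPlaces c d A N)).Ideals),
                  CyclotomicField (cycLevel 3 k' r.1) ℚ),
              -- (C1) Euler system [Kato 2004 (8.1.3), Prop. 8.12, Ex. 13.3]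
              IsEulerSystem (cyclotomicLevelsRat 3 (badPlaces c d A N)) (tateRep W 3) 3 z ∧
              -- (C2) unramified away from 3 [Kato 2004 (8.1.3), §8.2, Lemma 8.5]
              (∀ (k : ℕ) (r : (cyclotomicLevelsRat 3 (badPlaces c d A N)).Ideals) (v : HeightOneSpectrum (𝓞 ℚ)), ((Rat.HeightOneSpectrum.primesEquiv v : Nat.Primes) : ℕ) ≠ 3 →
                  ∀ 𝔓 ∈ v.primesAbove,
                    resLe (tateRep W 3).toTopRep
                        (inf_le_left : (cyclotomicLevelsRat 3 (badPlaces c d A N)).level k r.1 ⊓ 𝔓.inertia (absoluteGaloisGroup ℚ) ≤ (cyclotomicLevelsRat 3 (badPlaces c d A N)).level k r.1)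
                        1 (z k r) = 0) ∧
              -- (C4) Kato's Thm. 9.7 for the DEFINED value datum `katoLambda` (single completion, twist family)
              (∀ (k : ℕ) (r : (cyclotomicLevelsRat 3 (badPlaces c d A N)).Ideals),
                katoLambda W 3 k r.1 (w₀ k r.1) (Ψ k r.1) (hΨ k r.1) (three_mem_asIdeal_extension _ (w₀ k r.1))
                  (g k r.1) (hg k r.1) (dw k r.1) (hinjw k r.1) (hexw k r.1) (z k r) = (1 : ℚ_[3]) ⊗ₜ[ℚ] x k r) ∧
              -- (C5) the value law [Kato 2004 Thm. 9.7 ∘ Thm. 6.6 (1)]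
              (∀ (k : ℕ) (r : (cyclotomicLevelsRat 3 (badPlaces c d A N)).Ideals) (d' : ℤ) (χ : DirichletCharacter ℂ (cycLevel 3 k r.1)) (Lχ : ℂ → ℂ),
                  Int.gcd (c * d) (cycLevel 3 k r.1 * A) = 1 →
                  d * d' ≡ 1 [ZMOD (A : ℤ)] →
                  IsDepletedTwistedL P.f (cycLevel 3 k r.1) (3 * A) χ Lχ →
                    (χ (-1) = 1 →
                      charSum (cycLevel 3 k r.1) (ι (cycLevel 3 k r.1)) χ (x k r) =
                        (κK : ℂ) * (Lχ 1 / (plusPeriod P.f : ℂ)) *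
                          cuspFactor P.f true (fun n ↦ χ⁻¹ (n : ZMod (cycLevel 3 k r.1))) c d a A d') ∧
                    (χ (-1) = -1 →
                      charSum (cycLevel 3 k r.1) (ι (cycLevel 3 k r.1)) χ (x k r) =
                        -(κK : ℂ) * (Lχ 1 / (Complex.I * (minusPeriod P.f : ℂ))) *
                          cuspFactor P.f false (fun n ↦ χ⁻¹ (n : ZMod (cycLevel 3 k r.1))) c d a A d')))

include hKatoP in
set_option backward.isDefEq.respectTransparency false in
set_option maxHeartbeats 1600000 in
/-- **hKatoExᵘ (w2-c2's `hdual`-free Kato package, text of `KimAtThreeDeepLowerKatoPartsRescale` l.81–163 VERBATIM) from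
(P123), (DR), (S5b) and the print-shaped package hKatoPᵘ** (module docstring).  hKatoPᵘ displayed, the facts cite-only;
closes nothing. [cite: Kato2004Asterisque, (8.1.3) (p. 180), Prop. 8.12 (p. 186), §9.4 and Thm. 9.7 (pp. 188–189), Thm. 6.6 (1) (p. 163), Ex. 13.3 (pp. 224–225)]
[cite: Kato1993LNM1553, Ch. II §1.2.4, Prop. 1.2.3 and Thm. 1.4.1 (3)–(4)] [cite: BlochKato1990, §3 (Prop. 3.8, Ex. 3.11)]
[cite: CasselsFrohlichANT1967, Ch. II §10 Theorem (10.2) and Ch. VII §1.1] -/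
theorem katoExact_of_katoPrint_of_facts (hP : cupLogInjective_and_hasDualExp_of_isDeRham)
    (hDR : isDeRham_restrictedRationalTateRep) (hT : exists_smul_range_expStarCoord_iff_trace_log) :
    ∀ (W : WeierstrassCurve ℚ) [W.IsElliptic] [W.IsGloballyMinimal]
      [ContinuousSMul ℤ_[3] (W.tateModule 3)] [Module.Free ℤ_[3] (W.tateModule 3)]
      [Module.Finite ℤ_[3] (W.tateModule 3)],
      (∀ m : ℕ, W.HasSurjectiveModNGaloisRep (3 ^ m : ℕ)) →
      ∀ {N : ℕ} [NeZero N] (P : ModularParametrizationData W N), N = W.conductorNorm ℤ →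
        (∀ z ∈ P.L.lattice, ∃ w ∈ periodLattice P.f, z = P.c * w) →
        haveI : Fact (((3 : ℕ) : 𝓞 ℚ) ∈ ((Rat.HeightOneSpectrum.primesEquiv (R := 𝓞 ℚ)).symm ⟨3, Fact.out⟩).asIdeal) :=
          ⟨(natCast_mem_asIdeal_iff_eq_primesEquiv_symm _ Nat.prime_three).mpr rfl⟩
        letI := valuativeRelPlace ((Rat.HeightOneSpectrum.primesEquiv (R := 𝓞 ℚ)).symm ⟨3, Fact.out⟩)
        letI := topologicalSpacePlace ((Rat.HeightOneSpectrum.primesEquiv (R := 𝓞 ℚ)).symm ⟨3, Fact.out⟩)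
        haveI := isNonarchimedeanLocalField_place ((Rat.HeightOneSpectrum.primesEquiv (R := 𝓞 ℚ)).symm ⟨3, Fact.out⟩)
        haveI := charZero_place ((Rat.HeightOneSpectrum.primesEquiv (R := 𝓞 ℚ)).symm ⟨3, Fact.out⟩)
        letI := padicAlgebraPlace 3 ((Rat.HeightOneSpectrum.primesEquiv (R := 𝓞 ℚ)).symm ⟨3, Fact.out⟩)
        haveI := fact_not_isUnit_place 3 ((Rat.HeightOneSpectrum.primesEquiv (R := 𝓞 ℚ)).symm ⟨3, Fact.out⟩)
        haveI := isAdicComplete_place 3 ((Rat.HeightOneSpectrum.primesEquiv (R := 𝓞 ℚ)).symm ⟨3, Fact.out⟩)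
        ∃ (d : LocalNeronLineAt W 3 ((Rat.HeightOneSpectrum.primesEquiv (R := 𝓞 ℚ)).symm ⟨3, Fact.out⟩)),
        ∃ (ι : (n : ℕ) → (CyclotomicField n ℚ →+* ℂ)) (κK : ℝ)
          (Λ : ∀ (k' : ℕ) (r : Finset (HeightOneSpectrum (𝓞 ℚ))),
            H1 (tateRep W 3) (cycSubgroup 3 k' r) →ₗ[ℤ_[3]]
              ℚ_[3] ⊗[ℚ] CyclotomicField (cycLevel 3 k' r) ℚ),
          κK ≠ 0 ∧
          (∀ (j : ℕ) (r : Finset (HeightOneSpectrum (𝓞 ℚ)))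
            (Ψ : ℚ_[3] ⊗[ℚ] CyclotomicField (cycLevel 3 0 r) ℚ ≃ₐ[ℚ]
              (Π w : ((Rat.HeightOneSpectrum.primesEquiv (R := 𝓞 ℚ)).symm ⟨3, Fact.out⟩).Extension
                (𝓞 (CyclotomicField (cycLevel 3 0 r) ℚ)), w.1.adicCompletion (CyclotomicField (cycLevel 3 0 r) ℚ)))
            (hΨ : ∀ (s : ℚ_[3]) (x : CyclotomicField (cycLevel 3 0 r) ℚ)
              (w : ((Rat.HeightOneSpectrum.primesEquiv (R := 𝓞 ℚ)).symm ⟨3, Fact.out⟩).Extension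
                (𝓞 (CyclotomicField (cycLevel 3 0 r) ℚ))),
              Ψ (s ⊗ₜ[ℚ] x) w =
                algebraMap (CyclotomicField (cycLevel 3 0 r) ℚ) (w.1.adicCompletion (CyclotomicField (cycLevel 3 0 r) ℚ)) x *
                algebraMap (((Rat.HeightOneSpectrum.primesEquiv (R := 𝓞 ℚ)).symm ⟨3, Fact.out⟩).adicCompletion ℚ)
                  (w.1.adicCompletion (CyclotomicField (cycLevel 3 0 r) ℚ)) ((Padic.adicCompletionEquiv (𝓞 ℚ) ⟨3, Fact.out⟩) s)),
            ∃ (w₀ : ((Rat.HeightOneSpectrum.primesEquiv (R := 𝓞 ℚ)).symm ⟨3, Fact.out⟩).Extension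
                (𝓞 (CyclotomicField (cycLevel 3 0 r) ℚ)))
              (g : ((Rat.HeightOneSpectrum.primesEquiv (R := 𝓞 ℚ)).symm ⟨3, Fact.out⟩).Extension
                (𝓞 (CyclotomicField (cycLevel 3 0 r) ℚ)) → absoluteGaloisGroup ℚ)
              (hg : ∀ w : ((Rat.HeightOneSpectrum.primesEquiv (R := 𝓞 ℚ)).symm ⟨3, Fact.out⟩).Extension
                (𝓞 (CyclotomicField (cycLevel 3 0 r) ℚ)),
                sigma (cycLevel 3 0 r) (modNCyclotomicCharacter ℚ (cycLevel 3 0 r) (g w)) • w.1 = w₀.1),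
                letI := LocalField.charZero_adicCompletion w₀.1
                letI := LocalField.adicCompletionPadicAlgebra w₀.1 3 (three_mem_asIdeal_extension _ w₀)
                haveI : Fact (¬ IsUnit ((3 : ℕ) : integerC (w₀.1.adicCompletion (CyclotomicField (cycLevel 3 0 r) ℚ)))) :=
                  ⟨not_isUnit_natCast_integerC (LocalField.valuation_adicCompletion_natCast_lt_one w₀.1 3 (three_mem_asIdeal_extension _ w₀))⟩
                haveI := isAdicComplete_integerC_natCast (LocalField.valuation_adicCompletion_natCast_lt_one w₀.1 3 (three_mem_asIdeal_extension _ w₀))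
                ∃ (dw : LocalNeronLine W (LocalField.valuation_adicCompletion_natCast_lt_one w₀.1 3 (three_mem_asIdeal_extension _ w₀))
                  ((galRestrictPlace ((Rat.HeightOneSpectrum.primesEquiv (R := 𝓞 ℚ)).symm ⟨3, Fact.out⟩)).comp
                    (absGaloisRestrict (((Rat.HeightOneSpectrum.primesEquiv (R := 𝓞 ℚ)).symm ⟨3, Fact.out⟩).adicCompletion ℚ) (w₀.1.adicCompletion (CyclotomicField (cycLevel 3 0 r) ℚ)))))
                  (hinjw : (bdRPeriodRingData (LocalField.valuation_adicCompletion_natCast_lt_one w₀.1 3 (three_mem_asIdeal_extension _ w₀))).CupLogInjective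
                  (logCyclotomic 3) (localRationalTateRep W 3 ((galRestrictPlace ((Rat.HeightOneSpectrum.primesEquiv (R := 𝓞 ℚ)).symm ⟨3, Fact.out⟩)).comp
                    (absGaloisRestrict (((Rat.HeightOneSpectrum.primesEquiv (R := 𝓞 ℚ)).symm ⟨3, Fact.out⟩).adicCompletion ℚ) (w₀.1.adicCompletion (CyclotomicField (cycLevel 3 0 r) ℚ))))))
                  (hexw : ∀ z : contOneCocycles (localRationalTateRep W 3 ((galRestrictPlace ((Rat.HeightOneSpectrum.primesEquiv (R := 𝓞 ℚ)).symm ⟨3, Fact.out⟩)).comp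
                    (absGaloisRestrict (((Rat.HeightOneSpectrum.primesEquiv (R := 𝓞 ℚ)).symm ⟨3, Fact.out⟩).adicCompletion ℚ) (w₀.1.adicCompletion (CyclotomicField (cycLevel 3 0 r) ℚ))))).toTopRep,
                  (bdRPeriodRingData (LocalField.valuation_adicCompletion_natCast_lt_one w₀.1 3 (three_mem_asIdeal_extension _ w₀))).HasDualExp
                    (logCyclotomic 3) (localRationalTateRep W 3 ((galRestrictPlace ((Rat.HeightOneSpectrum.primesEquiv (R := 𝓞 ℚ)).symm ⟨3, Fact.out⟩)).comp
                    (absGaloisRestrict (((Rat.HeightOneSpectrum.primesEquiv (R := 𝓞 ℚ)).symm ⟨3, Fact.out⟩).adicCompletion ℚ) (w₀.1.adicCompletion (CyclotomicField (cycLevel 3 0 r) ℚ))))) fun σ => z.1 σ),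
                  (∀ (h : (tateLocalRep W 3 (Sum.inr ((Rat.HeightOneSpectrum.primesEquiv (R := 𝓞 ℚ)).symm ⟨3, Fact.out⟩))).cohomology 1),
                  (expStarOmegaHom (LocalField.valuation_adicCompletion_natCast_lt_one w₀.1 3 (three_mem_asIdeal_extension _ w₀))
                    ((galRestrictPlace ((Rat.HeightOneSpectrum.primesEquiv (R := 𝓞 ℚ)).symm ⟨3, Fact.out⟩)).comp
                    (absGaloisRestrict (((Rat.HeightOneSpectrum.primesEquiv (R := 𝓞 ℚ)).symm ⟨3, Fact.out⟩).adicCompletion ℚ) (w₀.1.adicCompletion (CyclotomicField (cycLevel 3 0 r) ℚ)))) dw hinjw hexw)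
                    (ContinuousRep.cohomologyRes (tateLocalRep W 3 (Sum.inr ((Rat.HeightOneSpectrum.primesEquiv (R := 𝓞 ℚ)).symm ⟨3, Fact.out⟩)))
                      (absGaloisRestrict (((Rat.HeightOneSpectrum.primesEquiv (R := 𝓞 ℚ)).symm ⟨3, Fact.out⟩).adicCompletion ℚ) (w₀.1.adicCompletion (CyclotomicField (cycLevel 3 0 r) ℚ))) 1 h) =
                  algebraMap (((Rat.HeightOneSpectrum.primesEquiv (R := 𝓞 ℚ)).symm ⟨3, Fact.out⟩).adicCompletion ℚ) (w₀.1.adicCompletion (CyclotomicField (cycLevel 3 0 r) ℚ)) (expStarOmegaAt d h)) ∧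
                  (∀ (w : ((Rat.HeightOneSpectrum.primesEquiv (R := 𝓞 ℚ)).symm ⟨3, Fact.out⟩).Extension
                    (𝓞 (CyclotomicField (cycLevel 3 0 r) ℚ)))
                  (y : H1 (tateRep W 3) (cycSubgroup 3 0 r))
                  (φ'' : contOneCocycles (subgroupRep (tateRep W 3).toTopRep (cycSubgroup 3 0 r)))
                  (ψT : contOneCocycles ((tateLocalRep W 3 (Sum.inr ((Rat.HeightOneSpectrum.primesEquiv (R := 𝓞 ℚ)).symm ⟨3, Fact.out⟩))).restrict
                    (absGaloisRestrict (((Rat.HeightOneSpectrum.primesEquiv (R := 𝓞 ℚ)).symm ⟨3, Fact.out⟩).adicCompletion ℚ) (w₀.1.adicCompletion (CyclotomicField (cycLevel 3 0 r) ℚ)))).toTopRep),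
                  oneCocycleClass _ φ'' = conjMap (tateRep W 3).toTopRep (cycSubgroup 3 0 r) (g w) 1 y →
                  (∀ σ, ψT.1 σ = φ''.1 ⟨absGaloisRestrictTower ℚ (((Rat.HeightOneSpectrum.primesEquiv (R := 𝓞 ℚ)).symm ⟨3, Fact.out⟩).adicCompletion ℚ) (w₀.1.adicCompletion (CyclotomicField (cycLevel 3 0 r) ℚ)) σ,
                    absGaloisRestrictTower_adicCompletion_mem_cycSubgroup r w₀ σ⟩) →
                  Ψ (Λ 0 r y) w = galAdicCompletionMap
                    (sigma (cycLevel 3 0 r) (modNCyclotomicCharacter ℚ (cycLevel 3 0 r) (g w)))⁻¹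
                    (inv_smul_eq_of_smul_eq (hg w))
                    ((expStarOmegaHom (LocalField.valuation_adicCompletion_natCast_lt_one w₀.1 3 (three_mem_asIdeal_extension _ w₀))
                    ((galRestrictPlace ((Rat.HeightOneSpectrum.primesEquiv (R := 𝓞 ℚ)).symm ⟨3, Fact.out⟩)).comp
                    (absGaloisRestrict (((Rat.HeightOneSpectrum.primesEquiv (R := 𝓞 ℚ)).symm ⟨3, Fact.out⟩).adicCompletion ℚ) (w₀.1.adicCompletion (CyclotomicField (cycLevel 3 0 r) ℚ)))) dw hinjw hexw) (oneCocycleClass _ ψT)))) ∧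
          ∀ (c d a : ℤ) (A : ℕ), 0 < A → Int.gcd c (6 * 3 * A) = 1 → Int.gcd d (6 * 3 * N) = 1 →
            ∃ (z : ∀ (k' : ℕ) (r : (cyclotomicLevelsRat 3 (badPlaces c d A N)).Ideals),
                  H1 (tateRep W 3) ((cyclotomicLevelsRat 3 (badPlaces c d A N)).level k' r.1))
              (x : ∀ (k' : ℕ) (r : (cyclotomicLevelsRat 3 (badPlaces c d A N)).Ideals),
                  CyclotomicField (cycLevel 3 k' r.1) ℚ),
              ZetaBody W 3 P.f ι κK Λ c d a A z x := by
  intro W _ _ _ _ _ htow N _ P hN hlat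
  haveI : Fact (((3 : ℕ) : 𝓞 ℚ) ∈ ((Rat.HeightOneSpectrum.primesEquiv (R := 𝓞 ℚ)).symm ⟨3, Fact.out⟩).asIdeal) :=
    ⟨(natCast_mem_asIdeal_iff_eq_primesEquiv_symm _ Nat.prime_three).mpr rfl⟩
  letI := valuativeRelPlace ((Rat.HeightOneSpectrum.primesEquiv (R := 𝓞 ℚ)).symm ⟨3, Fact.out⟩)
  letI := topologicalSpacePlace ((Rat.HeightOneSpectrum.primesEquiv (R := 𝓞 ℚ)).symm ⟨3, Fact.out⟩)
  haveI := isNonarchimedeanLocalField_place ((Rat.HeightOneSpectrum.primesEquiv (R := 𝓞 ℚ)).symm ⟨3, Fact.out⟩)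
  haveI := charZero_place ((Rat.HeightOneSpectrum.primesEquiv (R := 𝓞 ℚ)).symm ⟨3, Fact.out⟩)
  letI := padicAlgebraPlace 3 ((Rat.HeightOneSpectrum.primesEquiv (R := 𝓞 ℚ)).symm ⟨3, Fact.out⟩)
  haveI := fact_not_isUnit_place 3 ((Rat.HeightOneSpectrum.primesEquiv (R := 𝓞 ℚ)).symm ⟨3, Fact.out⟩)
  haveI := isAdicComplete_place 3 ((Rat.HeightOneSpectrum.primesEquiv (R := 𝓞 ℚ)).symm ⟨3, Fact.out⟩)
  obtain ⟨dK, ι, κK, w₀, Ψ, hΨ, g, hg, dw, hinjw, hexw, hκ0, hRES, hz⟩ := hKatoP W htow P hN hlat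
  -- Kato's Prop. 1.2.3 binders at `v₃` from the cite facts (w2-c3 g8), in this statement's instance spelling
  obtain ⟨hinj, hex⟩ :
      (bdRPeriodRingData (valuation_place_lt_one 3 ((Rat.HeightOneSpectrum.primesEquiv (R := 𝓞 ℚ)).symm ⟨3, Fact.out⟩))).CupLogInjective (logCyclotomic 3)
          (localRationalTateRep W 3 (galRestrictPlace ((Rat.HeightOneSpectrum.primesEquiv (R := 𝓞 ℚ)).symm ⟨3, Fact.out⟩))) ∧
        ∀ z : contOneCocycles (localRationalTateRep W 3 (galRestrictPlace ((Rat.HeightOneSpectrum.primesEquiv (R := 𝓞 ℚ)).symm ⟨3, Fact.out⟩))).toTopRep,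
          (bdRPeriodRingData (valuation_place_lt_one 3 ((Rat.HeightOneSpectrum.primesEquiv (R := 𝓞 ℚ)).symm ⟨3, Fact.out⟩))).HasDualExp (logCyclotomic 3)
            (localRationalTateRep W 3 (galRestrictPlace ((Rat.HeightOneSpectrum.primesEquiv (R := 𝓞 ℚ)).symm ⟨3, Fact.out⟩))) fun σ => z.1 σ :=
    hinj_hex_of_facts W 3 ((Rat.HeightOneSpectrum.primesEquiv (R := 𝓞 ℚ)).symm ⟨3, Fact.out⟩) hP hDR
  -- (DEF₀) on cocycles for `katoLambda`, at EVERY level (w2-acc5's `apply_katoLambda` + `expStarTowerMap_apply` +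
  -- `factorDef_of_H1toInt`)
  have hDEF : ∀ (k : ℕ) (r : Finset (HeightOneSpectrum (𝓞 ℚ))),
      letI := LocalField.charZero_adicCompletion (w₀ k r).1
      letI := LocalField.adicCompletionPadicAlgebra (w₀ k r).1 3 (three_mem_asIdeal_extension _ (w₀ k r))
      haveI : Fact (¬ IsUnit ((3 : ℕ) : integerC ((w₀ k r).1.adicCompletion (CyclotomicField (cycLevel 3 k r) ℚ)))) :=
        ⟨not_isUnit_natCast_integerC (LocalField.valuation_adicCompletion_natCast_lt_one (w₀ k r).1 3 (three_mem_asIdeal_extension _ (w₀ k r)))⟩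
      haveI := isAdicComplete_integerC_natCast (LocalField.valuation_adicCompletion_natCast_lt_one (w₀ k r).1 3 (three_mem_asIdeal_extension _ (w₀ k r)))
      ∀ (w : ((Rat.HeightOneSpectrum.primesEquiv (R := 𝓞 ℚ)).symm ⟨3, Fact.out⟩).Extension (𝓞 (CyclotomicField (cycLevel 3 k r) ℚ)))
        (y : H1 (tateRep W 3) (cycSubgroup 3 k r))
        (φ'' : contOneCocycles (subgroupRep (tateRep W 3).toTopRep (cycSubgroup 3 k r)))
        (ψT : contOneCocycles ((tateLocalRep W 3 (Sum.inr ((Rat.HeightOneSpectrum.primesEquiv (R := 𝓞 ℚ)).symm ⟨3, Fact.out⟩))).restrict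
          (absGaloisRestrict (((Rat.HeightOneSpectrum.primesEquiv (R := 𝓞 ℚ)).symm ⟨3, Fact.out⟩).adicCompletion ℚ) ((w₀ k r).1.adicCompletion (CyclotomicField (cycLevel 3 k r) ℚ)))).toTopRep),
        oneCocycleClass _ φ'' = conjMap (tateRep W 3).toTopRep (cycSubgroup 3 k r) (g k r w) 1 y →
        (∀ σ, ψT.1 σ = φ''.1 ⟨absGaloisRestrictTower ℚ (((Rat.HeightOneSpectrum.primesEquiv (R := 𝓞 ℚ)).symm ⟨3, Fact.out⟩).adicCompletion ℚ) ((w₀ k r).1.adicCompletion (CyclotomicField (cycLevel 3 k r) ℚ)) σ,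
          absGaloisRestrictTower_adicCompletion_mem_cycSubgroup_level k r (w₀ k r) σ⟩) →
        Ψ k r (katoLambda W 3 k r (w₀ k r) (Ψ k r) (hΨ k r) (three_mem_asIdeal_extension _ (w₀ k r))
            (g k r) (hg k r) (dw k r) (hinjw k r) (hexw k r) y) w =
          galAdicCompletionMap
            (sigma (cycLevel 3 k r) (modNCyclotomicCharacter ℚ (cycLevel 3 k r) (g k r w)))⁻¹
            (inv_smul_eq_of_smul_eq (hg k r w))
            ((expStarOmegaHom (LocalField.valuation_adicCompletion_natCast_lt_one (w₀ k r).1 3 (three_mem_asIdeal_extension _ (w₀ k r)))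
              ((galRestrictPlace ((Rat.HeightOneSpectrum.primesEquiv (R := 𝓞 ℚ)).symm ⟨3, Fact.out⟩)).comp
                (absGaloisRestrict (((Rat.HeightOneSpectrum.primesEquiv (R := 𝓞 ℚ)).symm ⟨3, Fact.out⟩).adicCompletion ℚ) ((w₀ k r).1.adicCompletion (CyclotomicField (cycLevel 3 k r) ℚ))))
              (dw k r) (hinjw k r) (hexw k r)) (oneCocycleClass _ ψT)) := by
    intro k r
    letI := LocalField.charZero_adicCompletion (w₀ k r).1
    letI := LocalField.adicCompletionPadicAlgebra (w₀ k r).1 3 (three_mem_asIdeal_extension _ (w₀ k r))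
    haveI : Fact (¬ IsUnit ((3 : ℕ) : integerC ((w₀ k r).1.adicCompletion (CyclotomicField (cycLevel 3 k r) ℚ)))) :=
      ⟨not_isUnit_natCast_integerC (LocalField.valuation_adicCompletion_natCast_lt_one (w₀ k r).1 3 (three_mem_asIdeal_extension _ (w₀ k r)))⟩
    haveI := isAdicComplete_integerC_natCast (LocalField.valuation_adicCompletion_natCast_lt_one (w₀ k r).1 3 (three_mem_asIdeal_extension _ (w₀ k r)))
    intro w y φ'' ψT hφ'' hψT
    -- `Place.Completion (inr v₃)` IS `ℚ_{v₃}`: read the packet's algebra structure on it (w2-acc5's currency)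
    letI instEF : Algebra (NumberField.Place.Completion (K := ℚ) (Sum.inr ((Rat.HeightOneSpectrum.primesEquiv (R := 𝓞 ℚ)).symm ⟨3, Fact.out⟩))) ((w₀ k r).1.adicCompletion (CyclotomicField (cycLevel 3 k r) ℚ)) :=
      inferInstanceAs (Algebra (((Rat.HeightOneSpectrum.primesEquiv (R := 𝓞 ℚ)).symm ⟨3, Fact.out⟩).adicCompletion ℚ) ((w₀ k r).1.adicCompletion (CyclotomicField (cycLevel 3 k r) ℚ)))
    have happ := apply_katoLambda W 3 k r (w₀ k r) (Ψ k r) (hΨ k r) (three_mem_asIdeal_extension _ (w₀ k r))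
      (g k r) (hg k r) (dw k r) (hinjw k r) (hexw k r) y w
    have htow := expStarTowerMap_apply W 3 k r (w₀ k r) (three_mem_asIdeal_extension _ (w₀ k r))
      (dw k r) (hinjw k r) (hexw k r) (conjMap (tateRep W 3).toTopRep (cycSubgroup 3 k r) (g k r w) 1 y)
    have hfac := factorDef_of_H1toInt W 3 k r ((Rat.HeightOneSpectrum.primesEquiv (R := 𝓞 ℚ)).symm ⟨3, Fact.out⟩) ((w₀ k r).1.adicCompletion (CyclotomicField (cycLevel 3 k r) ℚ))
      (absGaloisRestrictTower_adicCompletion_mem_cycSubgroup_prime 3 k r (w₀ k r))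
      (expStarOmegaHom (LocalField.valuation_adicCompletion_natCast_lt_one (w₀ k r).1 3 (three_mem_asIdeal_extension _ (w₀ k r)))
        ((galRestrictPlace ((Rat.HeightOneSpectrum.primesEquiv (R := 𝓞 ℚ)).symm ⟨3, Fact.out⟩)).comp
          (absGaloisRestrict (((Rat.HeightOneSpectrum.primesEquiv (R := 𝓞 ℚ)).symm ⟨3, Fact.out⟩).adicCompletion ℚ) ((w₀ k r).1.adicCompletion (CyclotomicField (cycLevel 3 k r) ℚ))))
        (dw k r) (hinjw k r) (hexw k r))
      (conjMap (tateRep W 3).toTopRep (cycSubgroup 3 k r) (g k r w) 1 y) φ'' hφ'' ψT hψT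
    exact happ.trans (congrArg (fun t => galAdicCompletionMap
      (sigma (cycLevel 3 k r) (modNCyclotomicCharacter ℚ (cycLevel 3 k r) (g k r w)))⁻¹
      (inv_smul_eq_of_smul_eq (hg k r w)) t) (htow.trans hfac))
  refine ⟨dK, ι, κK, fun k' r => katoLambda W 3 k' r (w₀ k' r) (Ψ k' r) (hΨ k' r)
      (three_mem_asIdeal_extension _ (w₀ k' r)) (g k' r) (hg k' r) (dw k' r) (hinjw k' r) (hexw k' r), hκ0, ?_, ?_⟩
  · -- the (DEF₀) block of hKatoExᵘ at the tame levels, for EVERY `Ψ'` with the pure-tensor formula (`Ψ' = Ψ 0 r`)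
    intro j r Ψ' hΨ'
    have hΨeq : Ψ' = Ψ 0 r := padicTensor_ext _ 3 Ψ' (Ψ 0 r) hΨ' (hΨ 0 r)
    subst hΨeq
    exact ⟨w₀ 0 r, g 0 r, hg 0 r, dw 0 r, hinjw 0 r, hexw 0 r, hRES 0 r,
      fun w y φ'' ψT hφ'' hψT => hDEF 0 r w y φ'' ψT hφ'' hψT⟩
  · -- `ZetaBody` = (C1) ∧ (C2) ∧ (C3a) ∧ (C3b) ∧ (C4) ∧ (C5); (C3a)/(C3b) are KERNEL on every row (this seat's tool)
    intro c d a A hA hc hd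
    obtain ⟨z, x, h1, h2, h4, h5⟩ := hz c d a A hA hc hd
    have hC3 := fun (k : ℕ) (r : Finset (HeightOneSpectrum (𝓞 ℚ))) =>
      zetaBody_C3_of_level_of_facts hT W k r
        (katoLambda W 3 k r (w₀ k r) (Ψ k r) (hΨ k r) (three_mem_asIdeal_extension _ (w₀ k r))
          (g k r) (hg k r) (dw k r) (hinjw k r) (hexw k r))
        dK hinj hex (Ψ k r) (hΨ k r) (w₀ k r) (g k r) (hg k r) (dw k r) (hinjw k r) (hexw k r) (hRES k r)
        (fun w y φ'' ψT hφ'' hψT => hDEF k r w y φ'' ψT hφ'' hψT)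
    exact ⟨z, x, h1, h2, fun k r σ y => (hC3 k r).1 σ y, fun k r y hy => (hC3 k r).2 y hy, h4, h5⟩


end Summit.BirchSwinnertonDyer.BirchSwinnertonDyer.Theorems.KimAtThreeDeepUpperOfKatoPrint

end
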